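/-
Copyright (c) 2026. All rights reserved.
Released under Apache 2.0 license as described in the file LICENSE.
Authors: HodgeCM publication cell (pub-hodgecm), GR lane, seat GR-2 (`pub-hodgecm-own-hyp34`).
-/
import Literature.NumberTheory.GelbartRogawski1991.CompatibleSplittingTransport
import HarnessLib

/-!
# [GelbartRogawski1991, Prop. 3.1.1] as a record is INVARIANT under change of carriers: transport of compatible
# splittings along homomorphisms of ALL THREE groups `Sp_𝐀(W)`, `Mp_𝐀(W)`, `G(𝐀)`, and along isomorphisms of data

Topic `NumberTheory/GelbartRogawski1991`; namespace `Literature.NumberTheory.GelbartRogawski1991.SplittingDatum`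
(sequel of `CompatibleSplitting` / `CompatibleSplittingTransport`).  KERNEL only: theorems over the ABSTRACT
`SplittingDatum`; no definition, no named fact, no proof hole; nothing of [GelbartRogawski1991] is asserted.

[GelbartRogawski1991, §3.1 p. 454 L17–42, Prop. 3.1.1 p. 455 L1–2] state the proposition for the printed objects
`Sp_𝐀(W)`, `Mp_𝐀(W)` (pairs `(g, M_g)` over "an" irreducible unitary `ρ_ψ`, "unique up to isomorphism"), `G(𝐀)`,
`G(F)`, `Sp_F(W)` and THE splitting `i` ("`π` splits uniquely over … `Sp_F(W)`").  The tree records the proposition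
as the predicate `SplittingDatum.CompatibleSplitting D` of an abstract datum `D` and proves it
(`GRConstruction.gru_shape`) at the datum of record `cmSplittingDatum …`, whose carriers are COORDINATE groups
(`Sp` = the symplectic group of `𝐀_F^{2n}` in a Darboux frame, `G(𝐀)` = unitary MATRICES over `𝐀_E`, `Mp` = the
smooth Schrödinger model `adelicMpCont`), while the statement-exact typing `Prop311AsPrinted` speaks of the
coordinate-free objects (`𝐀 ⊗_F V`, a Hilbert-space model of `ρ_ψ`).  Passing from one to the other changes EVERY
carrier by an isomorphism (a frame, a model of `ρ_ψ`); `CompatibleSplittingTransport` only moves `Mp` (same `Sp`,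
same `G(𝐀)`, same `ι`).  This file supplies the general bookkeeping, once and for all:

* `IsCompatible.transport` / `CompatibleSplitting.transport` — along homomorphisms `eSp : Sp →* Sp′`,
  `φ : Mp →* Mp′` over `eSp` (`π′ ∘ φ = eSp ∘ π`), `eG : G′(𝐀) →* G(𝐀)` with `ι′ = eSp ∘ ι ∘ eG`, `eG(G′(F)) ⊆ G(F)`
  and `φ ∘ i ⊆ range i′`, a (continuous) compatible `s` for `D` yields the (continuous) compatible
  `φ ∘ s ∘ eG` for `D′` (`φ`, `eG` continuous);
* `map_ratSplit_eq_of_unique` / `forall_map_ratSplit_mem_range_of_unique` — the clause "`φ ∘ i ⊆ range i′`" is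
  AUTOMATIC when `i′` is THE unique section of `π′` over `Sp′_F(W)` (the printed "[We] … splits uniquely"; in the
  tree: `Prop311.rationalSplitting_unique`, `Weil1964.adelicMpCont.ratThetaLiftCont_unique`) and `eSp` identifies
  `Sp_F(W)` with `Sp′_F(W)`: then `φ (i x) = i′ (eSp x)`;
* `CompatibleSplitting.iff_of_mulEquiv` (and `IsCompatible.transport_symm`) — along ISOMORPHISMS of all three
  carriers matching `π`, `ι`, `G(F)`, `Sp_F(W)` and `i`, `D.CompatibleSplitting ↔ D′.CompatibleSplitting`;
  `CompatibleSplitting.iff_of_mulEquiv_of_unique` — the same with the matching of `i` discharged by uniqueness.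

These are the formal content of the two printed parentheses "(`ρ_ψ` is unique up to isomorphism)" (p. 454 L21) and
"`W` coincides with `V`, but viewed as an `F`-vector space" (p. 454 L41): Proposition 3.1.1 does not depend on the
model of `ρ_ψ` nor on coordinates.  [folklore]-level algebra; the cite tags point at the printed sentences whose
independence of choices they formalise.

## References
* [GelbartRogawski1991] S. Gelbart, J. Rogawski, Invent. Math. 105 (1991) 445–472, §3.1 p. 454 L17–42, Prop. 3.1.1
  p. 455 L1–2.
* [MoeglinVignerasWaldspurger1987] C. Mœglin, M.-F. Vignéras, J.-L. Waldspurger, LNM 1291 (1987), Chap. 2 II.1 (B)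
  (the metaplectic group "ne dépend pas, à isomorphisme unique près, du modèle").
-/

set_option autoImplicit false

namespace Literature.NumberTheory.GelbartRogawski1991

namespace SplittingDatum

variable {Sp Mp GA Sp' Mp' GA' : Type*}
variable [Group Sp] [Group Mp] [Group GA] [Group Sp'] [Group Mp'] [Group GA']
variable {D : SplittingDatum Sp Mp GA} {D' : SplittingDatum Sp' Mp' GA'}

/-! ## Transport along homomorphisms of the three carriers -/

section Hom

/-- **Transport of a compatible splitting along homomorphisms of all three carriers.**  Let
`eSp : Sp_𝐀(W) → Sp′_𝐀(W′)`, `φ : Mp → Mp′` over `eSp` (`π′ (φ m) = eSp (π m)`), `eG : G′(𝐀) → G(𝐀)` with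
`ι′ = eSp ∘ ι ∘ eG`, `eG (G′(F)) ⊆ G(F)`, and let `φ` carry `i(Sp_F(W))` into `i′(Sp′_F(W′))`.  If `s` is compatible
for `D` then `φ ∘ s ∘ eG` is compatible for `D′`.  (`CompatibleSplittingTransport.IsCompatible.map` is the case
`eSp = id`, `eG = id`.) [cite: GelbartRogawski1991, §3.1 p. 454 L21–42 with Prop. 3.1.1 p. 455 L1–2] -/
theorem IsCompatible.transport (eSp : Sp →* Sp') (φ : Mp →* Mp') (eG : GA' →* GA)
    (hproj : ∀ m : Mp, D'.proj (φ m) = eSp (D.proj m))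
    (htoSp : ∀ g' : GA', D'.toSp g' = eSp (D.toSp (eG g')))
    (hrat : ∀ γ' ∈ D'.ratPts, eG γ' ∈ D.ratPts)
    (hsplit : ∀ x : D.spRat, φ (D.ratSplit x) ∈ D'.ratSplit.range)
    {s : GA →* Mp} (hs : D.IsCompatible s) : D'.IsCompatible ((φ.comp s).comp eG) := by
  refine ⟨fun g' => ?_, fun γ' hγ' => ?_⟩
  · rw [MonoidHom.comp_apply, MonoidHom.comp_apply, hproj, hs.1, htoSp]
  · obtain ⟨x, hx⟩ := hs.2 (eG γ') (hrat γ' hγ')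
    rw [MonoidHom.comp_apply, MonoidHom.comp_apply, ← hx]
    exact hsplit x

/-- **[GelbartRogawski1991, Prop. 3.1.1]'s conclusion transports along continuous homomorphisms of all three
carriers**: under the hypotheses of `IsCompatible.transport` with `φ` and `eG` continuous,
`D.CompatibleSplitting → D′.CompatibleSplitting`. [cite: GelbartRogawski1991, §3.1 p. 454 L21–42 with Prop. 3.1.1 p. 455 L1–2] -/
theorem CompatibleSplitting.transport [TopologicalSpace GA] [TopologicalSpace Mp] [TopologicalSpace GA']
    [TopologicalSpace Mp'] (eSp : Sp →* Sp') (φ : Mp →* Mp') (hφ : Continuous φ) (eG : GA' →* GA)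
    (heG : Continuous eG) (hproj : ∀ m : Mp, D'.proj (φ m) = eSp (D.proj m))
    (htoSp : ∀ g' : GA', D'.toSp g' = eSp (D.toSp (eG g')))
    (hrat : ∀ γ' ∈ D'.ratPts, eG γ' ∈ D.ratPts)
    (hsplit : ∀ x : D.spRat, φ (D.ratSplit x) ∈ D'.ratSplit.range)
    (h : D.CompatibleSplitting) : D'.CompatibleSplitting := by
  obtain ⟨s, hsc, hs⟩ := h
  exact ⟨(φ.comp s).comp eG, (hφ.comp hsc).comp heG, hs.transport eSp φ eG hproj htoSp hrat hsplit⟩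

/-- the topology-free form: a compatible splitting for `D` gives one for `D′`. [cite: GelbartRogawski1991, §3.1 Prop. 3.1.1 p. 455 L1–2] -/
theorem IsCompatible.exists_transport (eSp : Sp →* Sp') (φ : Mp →* Mp') (eG : GA' →* GA)
    (hproj : ∀ m : Mp, D'.proj (φ m) = eSp (D.proj m))
    (htoSp : ∀ g' : GA', D'.toSp g' = eSp (D.toSp (eG g')))
    (hrat : ∀ γ' ∈ D'.ratPts, eG γ' ∈ D.ratPts)
    (hsplit : ∀ x : D.spRat, φ (D.ratSplit x) ∈ D'.ratSplit.range)
    (h : ∃ s : GA →* Mp, D.IsCompatible s) : ∃ s' : GA' →* Mp', D'.IsCompatible s' := by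
  obtain ⟨s, hs⟩ := h
  exact ⟨(φ.comp s).comp eG, hs.transport eSp φ eG hproj htoSp hrat hsplit⟩

end Hom

/-! ## The clause `φ ∘ i ⊆ range i′` from the uniqueness of the rational section -/

section Unique

/-- **`φ ∘ i = i′ ∘ eSp` on `Sp_F(W)` when `i′` is THE unique section of `π′` over `Sp′_F(W′)`** ("`π` splits
uniquely over the group of `F`-rational points", p. 454 L35–36): if `φ : Mp → Mp′` lies over `eSp`, `eSp` restricts
to an isomorphism `e₀ : Sp_F(W) ≃ Sp′_F(W′)`, and every homomorphic section of `π′` over `Sp′_F(W′)` equals `i′`,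
then `φ (i x) = i′ (e₀ x)`.  (`φ ∘ i ∘ e₀⁻¹` is such a section.) [cite: GelbartRogawski1991, §3.1 p. 454 L35–36] -/
theorem map_ratSplit_eq_of_unique (eSp : Sp →* Sp') (φ : Mp →* Mp')
    (hproj : ∀ m : Mp, D'.proj (φ m) = eSp (D.proj m))
    (e₀ : D.spRat ≃* D'.spRat) (he₀ : ∀ x : D.spRat, ((e₀ x : D'.spRat) : Sp') = eSp (x : Sp))
    (huniq : ∀ j : D'.spRat →* Mp', (∀ y : D'.spRat, D'.proj (j y) = (y : Sp')) → j = D'.ratSplit)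
    (x : D.spRat) : φ (D.ratSplit x) = D'.ratSplit (e₀ x) := by
  have hsec : ∀ y : D'.spRat,
      D'.proj (((φ.comp D.ratSplit).comp e₀.symm.toMonoidHom) y) = (y : Sp') := fun y => by
    rw [MonoidHom.comp_apply, MonoidHom.comp_apply, MulEquiv.coe_toMonoidHom, hproj, D.proj_ratSplit, ← he₀,
      MulEquiv.apply_symm_apply]
  have h := DFunLike.congr_fun (huniq _ hsec) (e₀ x)
  rwa [MonoidHom.comp_apply, MonoidHom.comp_apply, MulEquiv.coe_toMonoidHom, MulEquiv.symm_apply_apply] at h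

/-- hence the hypothesis `hsplit` of `IsCompatible.transport` HOLDS: `φ (i x) ∈ range i′`.
[cite: GelbartRogawski1991, §3.1 p. 454 L35–36] -/
theorem forall_map_ratSplit_mem_range_of_unique (eSp : Sp →* Sp') (φ : Mp →* Mp')
    (hproj : ∀ m : Mp, D'.proj (φ m) = eSp (D.proj m))
    (e₀ : D.spRat ≃* D'.spRat) (he₀ : ∀ x : D.spRat, ((e₀ x : D'.spRat) : Sp') = eSp (x : Sp))
    (huniq : ∀ j : D'.spRat →* Mp', (∀ y : D'.spRat, D'.proj (j y) = (y : Sp')) → j = D'.ratSplit) :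
    ∀ x : D.spRat, φ (D.ratSplit x) ∈ D'.ratSplit.range := fun x =>
  ⟨e₀ x, (map_ratSplit_eq_of_unique eSp φ hproj e₀ he₀ huniq x).symm⟩

/-- **transport with the rational clause discharged by uniqueness**: along `(eSp, φ, eG)` as in
`IsCompatible.transport`, with `e₀ : Sp_F(W) ≃ Sp′_F(W′)` induced by `eSp` and `i′` the unique section of `π′` over
`Sp′_F(W′)`, compatibility transports with NO hypothesis on `i`. [cite: GelbartRogawski1991, §3.1 p. 454 L35–36, Prop. 3.1.1 p. 455 L1–2] -/
theorem IsCompatible.transport_of_unique (eSp : Sp →* Sp') (φ : Mp →* Mp') (eG : GA' →* GA)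
    (hproj : ∀ m : Mp, D'.proj (φ m) = eSp (D.proj m))
    (htoSp : ∀ g' : GA', D'.toSp g' = eSp (D.toSp (eG g')))
    (hrat : ∀ γ' ∈ D'.ratPts, eG γ' ∈ D.ratPts)
    (e₀ : D.spRat ≃* D'.spRat) (he₀ : ∀ x : D.spRat, ((e₀ x : D'.spRat) : Sp') = eSp (x : Sp))
    (huniq : ∀ j : D'.spRat →* Mp', (∀ y : D'.spRat, D'.proj (j y) = (y : Sp')) → j = D'.ratSplit)
    {s : GA →* Mp} (hs : D.IsCompatible s) : D'.IsCompatible ((φ.comp s).comp eG) :=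
  hs.transport eSp φ eG hproj htoSp hrat (forall_map_ratSplit_mem_range_of_unique eSp φ hproj e₀ he₀ huniq)

/-- … and so does `CompatibleSplitting` (continuous `φ`, `eG`). [cite: GelbartRogawski1991, §3.1 p. 454 L35–36, Prop. 3.1.1 p. 455 L1–2] -/
theorem CompatibleSplitting.transport_of_unique [TopologicalSpace GA] [TopologicalSpace Mp]
    [TopologicalSpace GA'] [TopologicalSpace Mp'] (eSp : Sp →* Sp') (φ : Mp →* Mp') (hφ : Continuous φ)
    (eG : GA' →* GA) (heG : Continuous eG) (hproj : ∀ m : Mp, D'.proj (φ m) = eSp (D.proj m))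
    (htoSp : ∀ g' : GA', D'.toSp g' = eSp (D.toSp (eG g')))
    (hrat : ∀ γ' ∈ D'.ratPts, eG γ' ∈ D.ratPts)
    (e₀ : D.spRat ≃* D'.spRat) (he₀ : ∀ x : D.spRat, ((e₀ x : D'.spRat) : Sp') = eSp (x : Sp))
    (huniq : ∀ j : D'.spRat →* Mp', (∀ y : D'.spRat, D'.proj (j y) = (y : Sp')) → j = D'.ratSplit)
    (h : D.CompatibleSplitting) : D'.CompatibleSplitting :=
  h.transport eSp φ hφ eG heG hproj htoSp hrat (forall_map_ratSplit_mem_range_of_unique eSp φ hproj e₀ he₀ huniq)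

end Unique

/-! ## Invariance along isomorphisms of splitting data -/

section Iso

/-- the matching hypotheses of an isomorphism of splitting data pass to the inverse isomorphism: `π` over `eSp⁻¹`.
[cite: GelbartRogawski1991, §3.1 p. 454 L21–27] -/
theorem proj_symm_eq (eSp : Sp ≃* Sp') (φ : Mp ≃* Mp')
    (hproj : ∀ m : Mp, D'.proj (φ m) = eSp (D.proj m)) (m' : Mp') :
    D.proj (φ.symm m') = eSp.symm (D'.proj m') := by
  rw [← eSp.symm_apply_apply (D.proj (φ.symm m')), ← hproj, MulEquiv.apply_symm_apply]

/-- … `ι` over `eSp⁻¹` and `eG⁻¹`. [cite: GelbartRogawski1991, §3.1 p. 454 L37–42] -/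
theorem toSp_symm_eq (eSp : Sp ≃* Sp') (eG : GA' ≃* GA)
    (htoSp : ∀ g' : GA', D'.toSp g' = eSp (D.toSp (eG g'))) (g : GA) :
    D.toSp g = eSp.symm (D'.toSp (eG.symm g)) := by
  rw [htoSp, MulEquiv.apply_symm_apply, MulEquiv.symm_apply_apply]

/-- … and `i` along `φ⁻¹`, `e₀⁻¹`. [cite: GelbartRogawski1991, §3.1 p. 454 L35–36] -/
theorem symm_ratSplit_eq (φ : Mp ≃* Mp') (e₀ : D.spRat ≃* D'.spRat)
    (hsplit : ∀ x : D.spRat, φ (D.ratSplit x) = D'.ratSplit (e₀ x)) (y : D'.spRat) :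
    φ.symm (D'.ratSplit y) = D.ratSplit (e₀.symm y) := by
  rw [← e₀.apply_symm_apply y, ← hsplit, MulEquiv.symm_apply_apply, MulEquiv.apply_symm_apply]

/-- **transport back along an isomorphism of splitting data**: with isomorphisms `eSp`, `φ`, `eG` matching `π`,
`ι`, the rational points (`γ′ ∈ G′(F) ↔ eG γ′ ∈ G(F)`) and the rational splittings (`φ (i x) = i′ (e₀ x)`), a
compatible `s′` for `D′` gives the compatible `φ⁻¹ ∘ s′ ∘ eG⁻¹` for `D`. [cite: GelbartRogawski1991, §3.1 p. 454 L21–42 with Prop. 3.1.1 p. 455 L1–2] -/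
theorem IsCompatible.transport_symm (eSp : Sp ≃* Sp') (φ : Mp ≃* Mp') (eG : GA' ≃* GA)
    (hproj : ∀ m : Mp, D'.proj (φ m) = eSp (D.proj m))
    (htoSp : ∀ g' : GA', D'.toSp g' = eSp (D.toSp (eG g')))
    (hrat : ∀ γ' : GA', γ' ∈ D'.ratPts ↔ eG γ' ∈ D.ratPts)
    (e₀ : D.spRat ≃* D'.spRat) (hsplit : ∀ x : D.spRat, φ (D.ratSplit x) = D'.ratSplit (e₀ x))
    {s' : GA' →* Mp'} (hs' : D'.IsCompatible s') :
    D.IsCompatible ((φ.symm.toMonoidHom.comp s').comp eG.symm.toMonoidHom) := by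
  refine hs'.transport eSp.symm.toMonoidHom φ.symm.toMonoidHom eG.symm.toMonoidHom (fun m' => ?_) (fun g => ?_)
    (fun γ hγ => ?_) (fun y => ?_)
  · rw [MulEquiv.coe_toMonoidHom, MulEquiv.coe_toMonoidHom, proj_symm_eq eSp φ hproj]
  · rw [MulEquiv.coe_toMonoidHom, MulEquiv.coe_toMonoidHom, toSp_symm_eq eSp eG htoSp]
  · rw [MulEquiv.coe_toMonoidHom]
    exact (hrat (eG.symm γ)).2 (by rwa [MulEquiv.apply_symm_apply])
  · rw [MulEquiv.coe_toMonoidHom, symm_ratSplit_eq φ e₀ hsplit]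
    exact ⟨e₀.symm y, rfl⟩

/-- **[GelbartRogawski1991, Prop. 3.1.1] as a record is invariant under isomorphism of splitting data.**  Let
`eSp : Sp_𝐀(W) ≃ Sp′_𝐀(W′)`, `φ : Mp ≃ Mp′` (a homeomorphism, over `eSp`), `eG : G′(𝐀) ≃ G(𝐀)` (a homeomorphism,
`ι′ = eSp ∘ ι ∘ eG`) match the rational points (`γ′ ∈ G′(F) ↔ eG γ′ ∈ G(F)`) and the rational splittings
(`φ (i x) = i′ (e₀ x)` for an isomorphism `e₀ : Sp_F(W) ≃ Sp′_F(W′)`).  Then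
`D.CompatibleSplitting ↔ D′.CompatibleSplitting` — the proposition does not depend on the model of `ρ_ψ`
("unique up to isomorphism", p. 454 L21) nor on coordinates ("`W` coincides with `V`, but viewed as an `F`-vector
space", p. 454 L41). [cite: GelbartRogawski1991, §3.1 p. 454 L21–42, Prop. 3.1.1 p. 455 L1–2; MoeglinVignerasWaldspurger1987, Chap. 2 II.1 (B)] -/
theorem CompatibleSplitting.iff_of_mulEquiv [TopologicalSpace GA] [TopologicalSpace Mp] [TopologicalSpace GA']
    [TopologicalSpace Mp'] (eSp : Sp ≃* Sp') (φ : Mp ≃* Mp') (hφ : Continuous φ) (hφ' : Continuous φ.symm)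
    (eG : GA' ≃* GA) (heG : Continuous eG) (heG' : Continuous eG.symm)
    (hproj : ∀ m : Mp, D'.proj (φ m) = eSp (D.proj m))
    (htoSp : ∀ g' : GA', D'.toSp g' = eSp (D.toSp (eG g')))
    (hrat : ∀ γ' : GA', γ' ∈ D'.ratPts ↔ eG γ' ∈ D.ratPts)
    (e₀ : D.spRat ≃* D'.spRat) (hsplit : ∀ x : D.spRat, φ (D.ratSplit x) = D'.ratSplit (e₀ x)) :
    D.CompatibleSplitting ↔ D'.CompatibleSplitting := by
  constructor
  · exact CompatibleSplitting.transport eSp.toMonoidHom φ.toMonoidHom hφ eG.toMonoidHom heG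
      (fun m => hproj m) (fun g' => htoSp g') (fun γ' hγ' => (hrat γ').1 hγ')
      (fun x => ⟨e₀ x, (hsplit x).symm⟩)
  · rintro ⟨s', hs'c, hs'⟩
    exact ⟨(φ.symm.toMonoidHom.comp s').comp eG.symm.toMonoidHom, (hφ'.comp hs'c).comp heG',
      hs'.transport_symm eSp φ eG hproj htoSp hrat e₀ hsplit⟩

/-- **the same with the matching of the rational splittings discharged by uniqueness** of the section of `π′` over
`Sp′_F(W′)` (so NO hypothesis relates `i` and `i′` beyond `e₀`, the restriction of `eSp` to the rational points):
`D.CompatibleSplitting ↔ D′.CompatibleSplitting`. [cite: GelbartRogawski1991, §3.1 p. 454 L21–42, Prop. 3.1.1 p. 455 L1–2] -/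
theorem CompatibleSplitting.iff_of_mulEquiv_of_unique [TopologicalSpace GA] [TopologicalSpace Mp]
    [TopologicalSpace GA'] [TopologicalSpace Mp'] (eSp : Sp ≃* Sp') (φ : Mp ≃* Mp') (hφ : Continuous φ)
    (hφ' : Continuous φ.symm) (eG : GA' ≃* GA) (heG : Continuous eG) (heG' : Continuous eG.symm)
    (hproj : ∀ m : Mp, D'.proj (φ m) = eSp (D.proj m))
    (htoSp : ∀ g' : GA', D'.toSp g' = eSp (D.toSp (eG g')))
    (hrat : ∀ γ' : GA', γ' ∈ D'.ratPts ↔ eG γ' ∈ D.ratPts)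
    (e₀ : D.spRat ≃* D'.spRat) (he₀ : ∀ x : D.spRat, ((e₀ x : D'.spRat) : Sp') = eSp (x : Sp))
    (huniq : ∀ j : D'.spRat →* Mp', (∀ y : D'.spRat, D'.proj (j y) = (y : Sp')) → j = D'.ratSplit) :
    D.CompatibleSplitting ↔ D'.CompatibleSplitting :=
  CompatibleSplitting.iff_of_mulEquiv eSp φ hφ hφ' eG heG heG' hproj htoSp hrat e₀
    (map_ratSplit_eq_of_unique eSp.toMonoidHom φ.toMonoidHom (fun m => hproj m) e₀ he₀ huniq)

end Iso

end SplittingDatum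

end Literature.NumberTheory.GelbartRogawski1991
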